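import Summits.HodgeConjecture.HodgeConjecture.Theorems.NoetherLefschetzOneUpK3TypeNetsOddPrimeTranscendental
import Literature.AlgebraicGeometry.HodgeTheory.HodgeRiemannPolarizabilityProofs
import Literature.AlgebraicGeometry.Motives.HodgeStructureQuotient
import Literature.AlgebraicGeometry.Motives.HodgeStructureDirectSum

/-!
# Route MarkmanPartnerTransport · crux `PicardThreeK3Squares` (stmt-HodgeConjecture-19652) —
# the transcendental lattice of a surface with `h^{2,0} = 1` PRESENTS ITS TRANSCENDENTAL PART:
# the `∀ (T, H, P, ε, j)` binder of the Kuga–Satake predicate is inhabited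

The tree's Kuga–Satake statement for a surface `S` (`HodgeTheory.IsKSCorrespondenceAlgebraicBetti`,
Floccari 2026 Conj. 3.3 in the `H²_tr`-form; file `HodgeTheory/KugaSatakeClassBetti`) and every theorem
consuming it quantify over PRESENTATIONS `(T, H, P, ε, j)` of the transcendental part of `S`
(`HodgeTheory.IsTranscendentalPartBetti`: an injective morphism of `ℚ`-Hodge structures
`j : T → H²_B(S)` onto `T(S)_ℚ = Hdg¹(S)^⊥` with `P = ε ∫_S (j · ∪ j ·)`, `ε = ±1`). Kuga–Satake
varieties exist for every presentation (`Surfaces.exists_isKugaSatakeVarietyBetti_of_isTranscendentalPartBetti'`),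
but no file of the tree CONSTRUCTS a presentation: every consumer carries
`hj : IsTranscendentalPartBetti …` as a hypothesis. This file constructs one for every smooth projective
surface `S` whose `(2,0)`-classes form a line `ℂσ`, `σ ≠ 0` (`h^{2,0}(S) = 1`; e.g. a K3 surface), for
the real Hodge model (`BettiUniverse.realHodgeModel`):

* `cupPairingBetti_baseChange_eq_traceC` — `(∫ ∪)_ℂ(x, y) = ∫_ℂ (Θ x ∪ Θ y)` (`traceC`);
* `lefschetzPow_one_eq_zero_of_mem_transcendental` — **`T(S)` is primitive**: `η ∪ Θ y = 0` for
  `y ∈ T(S)_ℂ` and the rational Kähler class `η` of a Kähler–rational datum (`η ∈ Hdg¹(S)`,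
  `T(S) = Hdg¹^⊥`, `H⁴(S; ℚ) ≅ ℚ` by the trace);
* `traceC_topClass_im`, `traceC_topClass_ne_zero` — `∫_ℂ Ω` is a non-zero REAL number for the top
  Kähler class `Ω` of the datum;
* `exists_polarization_form_eq` — **the form `ε ∫_S` POLARIZES the sub-Hodge structure `T(S)_ℚ`** for
  the sign `ε = -sign ∫_ℂ Ω` (`exists_sign_mul_traceC_topClass`): first Hodge–Riemann relation from
  `OddPrimeSquares.hodge_F_apply_eq_zero`, positivity `i^{p-q} ε ∫ x ∪ x̄ > 0` on `T^{p,q} ∖ 0` from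
  `KaehlerRationalDatum.hodgeRiemann_X` (Voisin I Thm. 6.32 on `S(ℂ)`: for a PRIMITIVE `(p,q)`-class
  `ξ ≠ 0` of degree `2`, `i^{p-q} · (-1) · ξ ∪ ξ̄ = t Ω`, `t > 0`);
* `exists_isTranscendentalPartBetti` — **the presentation**: `T(S)_ℚ` underlies an irreducible
  sub-Hodge structure `T` of K3 type of `H²_B(S)` (`OddPrimeSquares.exists_transcendental_subHodgeStructure`)
  and `(T, T.toHodgeStructure, P, ε, T.subtypeHom)` satisfies `IsTranscendentalPartBetti` for a
  polarization `P = ε ∫_S`, with `h^{2,0}(T) = 1`.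

Consequence (sequel files): the Kuga–Satake predicate of `S` can be INSTANTIATED, which is the first
step of the programme «KS-SELF» (a rational Hodge self-similitude of `T(S)` is algebraic granted the
Kuga–Satake statement for `S`, without Varesco's theorem as a named fact). THEOREMS ONLY: no definition,
no named fact, no sorry; nothing here says HC or the crux is proved. Prover seat hodge-nonav-19652-p1
(gen 14), `--supports stmt-HodgeConjecture-19652`.

References: C. Voisin, *Hodge Theory and Complex Algebraic Geometry I* (2002), §6.3.2 Thm. 6.32,
§7.1.2, Lemma 7.26, Lemma 7.30; D. Huybrechts, *Lectures on K3 Surfaces* (2016), Ch. 3 Lemma 3.1,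
Ch. 4 §2.5 ("the intersection form really is a polarization of `ℓ^⊥` (up to sign)"); B. van Geemen,
*Kuga-Satake varieties and the Hodge conjecture* (2000), §10.1–10.2.
-/

set_option linter.dupNamespace false

noncomputable section

namespace Summit.HodgeConjecture.HodgeConjecture.Theorems.MarkmanPartnerTransport.TranscendentalPresentation

open scoped TensorProduct
open CategoryTheory Literature.AlgebraicGeometry Literature.AlgebraicGeometry.Motives
open Literature.AlgebraicGeometry.HodgeTheory Literature.AlgebraicTopology.SingularHomology
open Literature.AlgebraicGeometry.Motives.HodgeStructure Literature.Geometry.Kaehler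
open Summit.HodgeConjecture.HodgeConjecture.Theorems.OddPrimeSquares

variable {S : SchemeOver ℂ}

/-- `H²_B(S)`: the weight-two `ℚ`-Hodge structure on `H²(S(ℂ); ℚ)` of the real Hodge model of `S`. -/
local notation3 "H²[" hS "]" =>
  bettiTwoHodgeStructure hS (BettiUniverse.realHodgeModel exists_isReal_hodgeModel_holds hS)
    (BettiUniverse.realHodgeModel_isHodgeSymmetric exists_isReal_hodgeModel_holds hS)

/-- `T(S)_ℚ = Hdg¹^⊥ ⊆ H²(S(ℂ); ℚ)`. -/
local notation3 "T[" hS "]" =>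
  transcendentalLatticeBetti hS (BettiUniverse.realHodgeModel exists_isReal_hodgeModel_holds hS)
    (BettiUniverse.realHodgeModel_isHodgeSymmetric exists_isReal_hodgeModel_holds hS)

/-- `Θ : ℂ ⊗_ℚ H²(S(ℂ); ℚ) → H²(S(ℂ); ℂ)`. -/
local notation3 "Θ[" S "]" => ofRatClassBaseChange (Motives.ComplexPoints S) (2 * 1)

/-! ### §1 The complexified intersection form through the complex trace -/

/-- **`(∫ ∪)_ℂ(x, y) = ∫_ℂ (Θ x ∪ Θ y)`**: the base change of the rational intersection form is the
complex canonical trace `traceC` of the cup product of the complexified classes.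
[cite: VoisinHodgeI2002, §7.1.2] -/
theorem cupPairingBetti_baseChange_eq_traceC (hS : IsSmoothProjective 2 S)
    (x y : ℂ ⊗[ℚ] bettiCohomology S (2 * 1)) :
    (cupPairingBetti hS).baseChange ℂ x y =
      traceC hS (cupProduct (rfl : 2 * 1 + 2 * 1 = 2 * 2) (Θ[S] x) (Θ[S] y)) := by
  induction x using TensorProduct.induction_on generalizing y with
  | zero => rw [LinearMap.map_zero₂, map_zero, LinearMap.map_zero₂, map_zero]
  | tmul a v =>
    induction y using TensorProduct.induction_on with
    | zero => rw [map_zero, map_zero, map_zero, map_zero]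
    | tmul b w =>
      rw [LinearMap.BilinForm.baseChange_tmul, ofRatClassBaseChange_tmul, ofRatClassBaseChange_tmul,
        LinearMap.map_smul₂, map_smul, map_smul, map_smul, cupPairingBetti_apply, ofRatClass_eq_ringChange,
        ofRatClass_eq_ringChange, ← singularCohomology.ringChange_cupProduct, ← ofRatClass_eq_ringChange,
        traceC_ofRatClass, Algebra.smul_def, smul_eq_mul, smul_eq_mul]
      ring
    | add y₁ y₂ h₁ h₂ => rw [map_add, map_add, h₁, h₂, map_add, map_add]
  | add x₁ x₂ h₁ h₂ =>
    rw [LinearMap.map_add₂, h₁, h₂, map_add, LinearMap.map_add₂, map_add]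

/-! ### §2 The transcendental lattice is primitive for a rational Kähler class -/

/-- **The rational Kähler class of a Kähler–rational datum is a Hodge class**: `η ∈ Hdg¹(S)` (`η ⊗ 1`
is of type `(1,1)`, `KaehlerRationalDatum.isOfHodgeType_Hη`). [cite: VoisinHodgeI2002, §7.1.2] -/
theorem eta_mem_hodgeClasses (hS : IsSmoothProjective 2 S) (D : KaehlerRationalDatum 2 S) :
    (show bettiCohomology S (2 * 1) from D.η) ∈ (H²[hS]).hodgeClasses 1 := by
  rw [bettiTwoHodgeStructure, cast_hodgeClasses]
  exact (BettiUniverse.realHodgeModel exists_isReal_hodgeModel_holds hS).mem_hodgeClasses_of_isOfHodgeType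
    hS hodgePQ_independent_of_hodgeModel_holds _ (p := 1) (by exact D.isOfHodgeType_Hη)

/-- `η ∪ t = 0` in `H⁴(S(ℂ); ℂ)` for a rational class `t ∈ T(S)_ℚ = Hdg¹^⊥` (`∫ η ∪ t = 0` and
`H⁴(S(ℂ); ℚ)` is detected by the trace). [cite: Huybrechts2016K3, Ch. 3 Lemma 3.1] -/
theorem cup_eta_ofRatClass_eq_zero (hS : IsSmoothProjective 2 S) (D : KaehlerRationalDatum 2 S)
    {t : bettiCohomology S (2 * 1)} (ht : t ∈ T[hS]) :
    cupProduct (rfl : 2 * 1 + 2 * 1 = 2 * 2) D.Hη (ofRatClass (Motives.ComplexPoints S) (2 * 1) t) = 0 := by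
  have h0 : cupPairingBetti hS (show bettiCohomology S (2 * 1) from D.η) t = 0 :=
    (mem_transcendentalLatticeBetti_iff hS _ _ t).1 ht _ (eta_mem_hodgeClasses hS D)
  rw [cupPairingBetti_apply] at h0
  have h1 := eq_zero_of_trace_eq_zero hS h0
  have h2 := congrArg (ofRatClass (Motives.ComplexPoints S) (2 * 2)) h1
  rw [map_zero, ofRatClass_eq_ringChange, singularCohomology.ringChange_cupProduct,
    ← ofRatClass_eq_ringChange, ← ofRatClass_eq_ringChange] at h2
  exact h2

/-- **`T(S)` is primitive**: `L_η (Θ y) = η ∪ Θ y = 0` for every `y ∈ T(S)_ℚ ⊗ ℂ`.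
[cite: VoisinHodgeI2002, §6.2.3 Def. 6.24] [cite: Huybrechts2016K3, Ch. 3 Lemma 3.1] -/
theorem lefschetzPow_one_eq_zero_of_mem_transcendental (hS : IsSmoothProjective 2 S)
    (D : KaehlerRationalDatum 2 S) {y : ℂ ⊗[ℚ] bettiCohomology S (2 * 1)}
    (hy : y ∈ (T[hS]).baseChange ℂ) :
    lefschetzPow D.Hη (0 + 1) (2 * 1) (Θ[S] y) = 0 := by
  rw [lefschetzPow_succ, LinearMap.comp_apply, lefschetzPow_zero, LinearMap.id_apply,
    lefschetzOperator_apply]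
  obtain ⟨u, rfl⟩ := hy
  induction u using TensorProduct.induction_on with
  | zero => rw [map_zero, map_zero, map_zero]
  | tmul c t =>
    rw [LinearMap.baseChange_tmul, Submodule.subtype_apply, ofRatClassBaseChange_tmul, map_smul]
    have h := cup_eta_ofRatClass_eq_zero hS D t.2
    have e : cupProduct (show 2 + 2 * 1 = 2 * 1 + 2 * 0 + 2 from rfl) D.Hη
        (ofRatClass (Motives.ComplexPoints S) (2 * 1) (t : bettiCohomology S (2 * 1))) = 0 := h
    rw [e, smul_zero]
  | add u₁ u₂ h₁ h₂ => rw [map_add, map_add, map_add, h₁, h₂, add_zero]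

/-! ### §3 The top Kähler class has non-zero real trace -/

/-- `∫_ℂ Ω = λ_ℂ(Ω) · ∫ v₀` for the rational generator `v₀` of `H⁴(S(ℂ); ℚ)`. [folklore] -/
theorem traceC_topClass_eq (hS : IsSmoothProjective 2 S) (D : KaehlerRationalDatum 2 S) :
    traceC hS D.topClass = cTopCoord hS D.topClass * algebraMap ℚ ℂ (trace hS (ratTopVec hS)) := by
  conv_lhs => rw [← cTopCoord_smul_self hS D.topClass]
  rw [map_smul, traceC_ofRatClass, smul_eq_mul]

/-- **`∫_ℂ Ω` is real.** [cite: VoisinHodgeI2002, Cor. 6.12] -/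
theorem traceC_topClass_im (hS : IsSmoothProjective 2 S) (D : KaehlerRationalDatum 2 S) :
    (traceC hS D.topClass).im = 0 := by
  rw [traceC_topClass_eq hS D, Complex.mul_im, D.im_cTopCoord_topClass hS, eq_ratCast, Complex.ratCast_im,
    Complex.ratCast_re, mul_zero, zero_mul, add_zero]

/-- **`∫_ℂ Ω ≠ 0`** (`Ω ≠ 0` spans the top degree, detected by the trace). [cite: VoisinHodgeI2002, §3.1.3 Cor. 3.9] -/
theorem traceC_topClass_ne_zero (hS : IsSmoothProjective 2 S) (D : KaehlerRationalDatum 2 S) :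
    traceC hS D.topClass ≠ 0 := fun h =>
  D.topClass_ne_zero hS (eq_zero_of_traceC_eq_zero hS h)

/-- **A sign `ε ∈ {±1}` with `ε · ∫_ℂ Ω = -|∫_ℂ Ω| < 0`** — the sign making `ε ∫_S` a polarization of
`T(S)_ℚ` (Huybrechts Ch. 4 §2.5: "up to sign"; the tree's canonical trace is normalised only up to a
universal sign, so the sign is COMPUTED here, `ε = -sign ∫_ℂ Ω`, rather than asserted).
[cite: Huybrechts2016K3, Ch. 4 §2.5] -/
theorem exists_sign_mul_traceC_topClass (hS : IsSmoothProjective 2 S) (D : KaehlerRationalDatum 2 S) :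
    ∃ (ε : ℤˣ) (r : ℝ), 0 < r ∧ ((ε : ℤ) : ℂ) * traceC hS D.topClass = -(r : ℂ) := by
  have him := traceC_topClass_im hS D
  have hne := traceC_topClass_ne_zero hS D
  have hre : (traceC hS D.topClass).re ≠ 0 := fun h => hne (Complex.ext h him)
  have heq : traceC hS D.topClass = ((traceC hS D.topClass).re : ℂ) :=
    Complex.ext (by simp) (by simp [him])
  rcases lt_or_gt_of_ne hre with hneg | hpos
  · refine ⟨1, -(traceC hS D.topClass).re, neg_pos.2 hneg, ?_⟩
    rw [heq, Complex.ofReal_re]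
    push_cast
    ring
  · refine ⟨-1, (traceC hS D.topClass).re, hpos, ?_⟩
    rw [heq, Complex.ofReal_re]
    push_cast
    ring

/-! ### §4 Hodge–Riemann on the transcendental lattice -/

/-- Pieces of `H²_B(S)` with a negative index vanish. [cite: VoisinHodgeI2002, §7.1.1] -/
theorem piece_eq_bot_of_neg (hS : IsSmoothProjective 2 S) {p q : ℤ} (hpq : p + q = 2) (h : p < 0 ∨ q < 0) :
    (H²[hS]).piece p q = ⊥ := by
  have hF : ∀ r : ℤ, 2 < r → (H²[hS]).F r = ⊥ := fun r hr => by
    show (BettiUniverse.hodge exists_isReal_hodgeModel_holds hS (2 * 1)).F r = ⊥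
    rw [BettiUniverse.hodge_F]
    exact HodgeModel.ratF_eq_bot _ hS (2 * 1) (by push_cast; omega)
  rcases h with h | h
  · refine eq_bot_iff.2 ((HodgeStructure.piece_le_complexConj_F _ p q).trans ?_)
    rw [hF q (by omega), HodgeStructure.complexConj_bot]
  · exact eq_bot_iff.2 ((HodgeStructure.piece_le_F _ p q).trans (hF p (by omega)).le)

/-- **Hodge–Riemann for the intersection form on `T(S)`**: for `0 ≠ y ∈ T(S)_ℚ ⊗ ℂ` of type `(p, q)`,
`i^{p-q} · ε · (∫ ∪)_ℂ(y, ȳ)` is a POSITIVE real, `ε` a sign with `ε ∫_ℂ Ω < 0` (Voisin I Thm. 6.32 for the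
primitive class `Θ y`, `KaehlerRationalDatum.hodgeRiemann_X`, read through `traceC`).
[cite: VoisinHodgeI2002, §6.3.2 Thm. 6.32 and §7.1.2] -/
theorem hodgeRiemann_transcendental (hS : IsSmoothProjective 2 S) (D : KaehlerRationalDatum 2 S)
    {ε : ℤˣ} {r : ℝ} (hr : 0 < r) (hε : ((ε : ℤ) : ℂ) * traceC hS D.topClass = -(r : ℂ))
    {p q : ℤ} (hpq : p + q = 2)
    {y : ℂ ⊗[ℚ] bettiCohomology S (2 * 1)} (hyT : y ∈ (T[hS]).baseChange ℂ)
    (hy : y ∈ (H²[hS]).piece p q) (hy0 : y ≠ 0) :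
    ∃ r' : ℝ, 0 < r' ∧
      Complex.I ^ p * (Complex.I ^ q)⁻¹ *
          (((ε : ℤ) : ℂ) * (cupPairingBetti hS).baseChange ℂ y (HodgeStructure.conj y)) = r' := by
  -- the type is `(p', q')` with naturals `p' + q' = 2`
  obtain ⟨p', rfl⟩ : ∃ p' : ℕ, (p' : ℤ) = p := by
    rcases lt_or_ge p 0 with h | h
    · exact absurd (by simpa [piece_eq_bot_of_neg hS hpq (Or.inl h)] using hy) hy0
    · exact ⟨p.toNat, Int.toNat_of_nonneg h⟩
  obtain ⟨q', rfl⟩ : ∃ q' : ℕ, (q' : ℤ) = q := by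
    rcases lt_or_ge q 0 with h | h
    · exact absurd (by simpa [piece_eq_bot_of_neg hS hpq (Or.inr h)] using hy) hy0
    · exact ⟨q.toNat, Int.toNat_of_nonneg h⟩
  have hpq' : p' + q' = 2 * 1 := by omega
  -- the complexified class `ξ = Θ y` is a non-zero primitive `(p', q')`-class
  have hξ : IsOfHodgeType 2 S (2 * 1) p' q' (Θ[S] y) := by
    have h := (BettiUniverse.mem_hodge_piece_iff exists_isReal_hodgeModel_holds
      hodgePQ_independent_of_hodgeModel_holds hS hpq' y).1
    rw [bettiTwoHodgeStructure, cast_piece] at hy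
    exact h hy
  have hξ0 : Θ[S] y ≠ 0 := fun h => hy0 (ofRatClassBaseChange_injective _ _ (by rw [h, map_zero]))
  have hprim := lefschetzPow_one_eq_zero_of_mem_transcendental hS D hyT
  obtain ⟨t, ht, heq⟩ := D.hodgeRiemann_X hS (a := 2 * 1) (s := p') (t' := q') (r₀ := 0) rfl rfl hξ hξ0 hprim
  -- read the Hodge–Riemann identity through the complex trace
  have hcup : cupProduct (show 2 * 1 + 2 * 0 + 2 * 1 = 2 * 2 from rfl) (lefschetzPow D.Hη 0 (2 * 1) (Θ[S] y))
      (conjClass _ (2 * 1) (Θ[S] y)) = cupProduct (rfl : 2 * 1 + 2 * 1 = 2 * 2) (Θ[S] y)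
        (Θ[S] (HodgeStructure.conj y)) := by
    rw [lefschetzPow_zero, LinearMap.id_apply,
      KaehlerRationalDatum.ofRatClassBaseChange_conj hS
        (BettiUniverse.realHodgeModel exists_isReal_hodgeModel_holds hS)]
  have hsign : (-1 : ℂ) ^ (2 * 1 * (2 * 1 - 1) / 2) = -1 := by norm_num
  rw [hcup, hsign] at heq
  have htr := congrArg (traceC hS) heq
  rw [map_smul, map_smul, smul_eq_mul, smul_eq_mul, ← cupPairingBetti_baseChange_eq_traceC] at htr
  refine ⟨t * r, mul_pos ht hr, ?_⟩
  have hI : Complex.I ^ (p' : ℤ) * (Complex.I ^ (q' : ℤ))⁻¹ = Complex.I ^ ((p' : ℤ) - q') := by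
    rw [zpow_sub₀ Complex.I_ne_zero, div_eq_mul_inv]
  rw [hI]
  calc Complex.I ^ ((p' : ℤ) - q') * (((ε : ℤ) : ℂ) * (cupPairingBetti hS).baseChange ℂ y (HodgeStructure.conj y))
      = -((ε : ℤ) : ℂ) *
          (Complex.I ^ ((p' : ℤ) - q') * -1 * (cupPairingBetti hS).baseChange ℂ y (HodgeStructure.conj y)) := by
        ring
    _ = -((ε : ℤ) : ℂ) * ((t : ℂ) * traceC hS D.topClass) := by rw [htr]
    _ = -(t : ℂ) * (((ε : ℤ) : ℂ) * traceC hS D.topClass) := by ring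
    _ = ((t * r : ℝ) : ℂ) := by rw [hε]; push_cast; ring

/-! ### §5 The polarization `ε ∫_S` of the transcendental lattice -/

/-- Base change of a scalar multiple of a bilinear form. [folklore] -/
private theorem baseChange_smul_apply {V : Type*} [AddCommGroup V] [Module ℚ V] (c : ℚ)
    (B : LinearMap.BilinForm ℚ V) (x y : ℂ ⊗[ℚ] V) :
    (c • B).baseChange ℂ x y = (c : ℂ) * B.baseChange ℂ x y := by
  induction x using TensorProduct.induction_on generalizing y with
  | zero => rw [LinearMap.map_zero₂, LinearMap.map_zero₂, mul_zero]
  | tmul a v =>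
    induction y using TensorProduct.induction_on with
    | zero => rw [map_zero, map_zero, mul_zero]
    | tmul b w =>
      rw [LinearMap.BilinForm.baseChange_tmul, LinearMap.BilinForm.baseChange_tmul, LinearMap.smul_apply,
        LinearMap.smul_apply, smul_eq_mul, Algebra.smul_def, Algebra.smul_def, map_mul, eq_ratCast]
      ring
    | add y₁ y₂ h₁ h₂ => rw [map_add, map_add, h₁, h₂, mul_add]
  | add x₁ x₂ h₁ h₂ => rw [LinearMap.map_add₂, LinearMap.map_add₂, h₁, h₂, mul_add]

/-- **The form `ε ∫_S (· ∪ ·)` polarizes the sub-Hodge structure `T(S)_ℚ ⊆ H²_B(S)`**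
(Huybrechts Ch. 4 §2.5 / van Geemen 1.8: the intersection form, with the sign `ε` of
`exists_sign_mul_traceC_topClass`, polarizes the K3-type structure `T(S)_ℚ`): symmetric;
`F^p ⊥ F^{3-p}` (`OddPrimeSquares.hodge_F_apply_eq_zero`); `i^{p-q} ε ∫ x ∪ x̄ > 0` on `T^{p,q} ∖ 0`
(`hodgeRiemann_transcendental`). Stated as the existence of a polarization with the prescribed form.
[cite: Huybrechts2016K3, Ch. 4 §2.5] [cite: VoisinHodgeI2002, §7.1.2 and Lemma 7.26] -/
theorem exists_polarization_form_eq (hS : IsSmoothProjective 2 S) (T : SubHodgeStructure (H²[hS]))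
    (hT : T.toSubmodule = T[hS]) :
    ∃ (ε : ℤˣ) (P : T.toHodgeStructure.Polarization),
      P.form = ((ε : ℤ) : ℚ) • (cupPairingBetti hS).compl₁₂ T.toSubmodule.subtype T.toSubmodule.subtype := by
  obtain ⟨D⟩ := nonempty_kaehlerRationalDatum hS
  obtain ⟨ε, r, hr, hε⟩ := exists_sign_mul_traceC_topClass hS D
  refine ⟨ε,
    { form := ((ε : ℤ) : ℚ) • (cupPairingBetti hS).compl₁₂ T.toSubmodule.subtype T.toSubmodule.subtype
      flip_form := ?_
      form_apply_eq_zero := ?_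
      pos := ?_ }, rfl⟩
  · have h2 : (2 : ℤ).negOnePow = 1 := by decide
    rw [h2, Units.val_one, one_smul]
    refine LinearMap.ext fun x => LinearMap.ext fun y => ?_
    simp only [LinearMap.BilinForm.flip_apply, LinearMap.smul_apply, LinearMap.compl₁₂_apply,
      Submodule.subtype_apply]
    rw [(cupPairingBetti_isSymm hS).eq]
  · intro p x hx y hy
    rw [SubHodgeStructure.toHodgeStructure_F, Submodule.mem_comap] at hx hy
    rw [baseChange_smul_apply, baseChange_compl₁₂, hodge_F_apply_eq_zero hS p _ hx _ (by
      convert hy using 2; ring), mul_zero]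
  · intro p q hpq x hx hx0
    rw [SubHodgeStructure.mem_piece_iff] at hx
    have hx0' : T.toSubmodule.subtype.baseChange ℂ x ≠ 0 := fun h => hx0
      (baseChange_injective_of_injective T.toSubmodule.injective_subtype (by rw [h, map_zero]))
    have hxT : T.toSubmodule.subtype.baseChange ℂ x ∈ (T[hS]).baseChange ℂ := by
      rw [← hT]
      exact ⟨x, rfl⟩
    obtain ⟨r', hr', h⟩ := hodgeRiemann_transcendental hS D hr hε hpq hxT hx hx0'
    refine ⟨r', hr', ?_⟩
    rw [baseChange_smul_apply, baseChange_compl₁₂, ← conj_baseChange]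
    push_cast at h ⊢
    exact h

/-! ### §6 The presentation -/

/-- **The transcendental lattice presents the transcendental part.** For a smooth projective surface
`S` whose `(2,0)`-classes form a line `ℂσ` with `σ ≠ 0` (`h^{2,0}(S) = 1`): `T(S)_ℚ = Hdg¹(S)^⊥` underlies
an irreducible sub-Hodge structure `T` of K3 type of `H²_B(S)` (real Hodge model), `h^{2,0}(T) = 1`, and
for some polarization `P` of `T` and sign `ε` the datum `(T, P, ε, T ↪ H²_B(S))` is a presentation of the
transcendental part in the sense of the Kuga–Satake records (`IsTranscendentalPartBetti`: injective
morphism of Hodge structures onto `T(S)_ℚ` with `P = ε ∫_S (· ∪ ·)`) — the `∀ (T, H, P, ε, j)` binder of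
`IsKSCorrespondenceAlgebraicBetti` is INHABITED for every such surface. [cite: vanGeemen2000KugaSatakeHC, §10.1–10.2]
[cite: Huybrechts2016K3, Ch. 3 Lemma 3.1 and Ch. 4 §2.5] [cite: Floccari2026, §3.3 Rem. 3.4] -/
theorem exists_isTranscendentalPartBetti (hS : IsSmoothProjective 2 S) {σ : complexBetti S (2 * 1)}
    (hσ : IsOfHodgeType 2 S (2 * 1) 2 0 σ) (hσ0 : σ ≠ 0)
    (hline : ∀ c : complexBetti S (2 * 1), IsOfHodgeType 2 S (2 * 1) 2 0 c → ∃ t : ℂ, c = t • σ) :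
    ∃ (T : SubHodgeStructure (H²[hS])) (P : T.toHodgeStructure.Polarization) (ε : ℤˣ),
      T.toSubmodule = T[hS] ∧ T.toHodgeStructure.IsIrreducible ∧ T.toHodgeStructure.IsOfK3Type ∧
      T.toHodgeStructure.hodgeNumber 2 0 = 1 ∧
      IsTranscendentalPartBetti hS _ _ T.toHodgeStructure P ε T.subtypeHom := by
  obtain ⟨T, hT, hirr, hK3, -⟩ := exists_transcendental_subHodgeStructure hS hσ hσ0 hline
  obtain ⟨ε, P, hP⟩ := exists_polarization_form_eq hS T hT
  refine ⟨T, P, ε, hT, hirr, hK3, hK3.1, T.subtypeHom_injective, ?_, hP⟩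
  rw [SubHodgeStructure.subtypeHom_toLinearMap, Submodule.range_subtype, hT]

end Summit.HodgeConjecture.HodgeConjecture.Theorems.MarkmanPartnerTransport.TranscendentalPresentation

end
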